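import Mathlib
import Literature.NumberTheory.LFunctions.Zhang2022.Section2SmoothWeight
import Literature.NumberTheory.LFunctions.Zhang2022.Section5Lemma54DeltaDeriv
import HarnessLib

/-!
# Zhang (2022), §5, proof of Lemma 5.3, case `x ≤ t₀^{1.02}`: the contour shift behind (5.11) and
# the resulting explicit form of (5.8) `Δ(x) = ω(1/2+2πix)(1 + O(α)) + O(ε)`, kernel-checked

Topic `Literature/NumberTheory/LFunctions/Zhang2022` (Landau–Siegel autopsy tree; verdict-neutral).
Y. Zhang, *Discrete mean estimates and the Landau–Siegel zero*, arXiv:2211.02515v1 (2022) — **an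
unrefereed manuscript, a claimed result under adjudication** (cell pub-zhang: audit + repair census
of arXiv:2211.02515; no claim about Landau–Siegel).

Glossary: `\l` = `𝓛 = log D`; `𝓛₂ = 𝓛^{400}` ((2.15)); `α` (2.7); `ε = exp{−c𝓛^{10}}` (§4);
`u* = 𝓛₂^{−1}𝓛⁵`, `v* = π(t₀ − x)/𝓛₂²`. Source text, §5 pp. 10–11 (proof of Lemma 5.3):

> By the relation `∫ exp{2πi(t₀−x)u − 𝓛₂²u²} du = ω(1/2+2πix)` and Cauchy's theorem, the proof
> of (5.8) is reduced to showing that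
> `∫_{L_j} exp{2πi(t₀−x)w − 𝓛₂²w²}(f*(x,w) − 1) dw ≪ α ω(1/2+2πix) + ε`   (5.11)
> for `1 ≤ j ≤ 5`, where `L_j` denote the segments `L₁ = (−∞, −u*]`, `L₂ = [−u*, −u*+iv*]`,
> `L₃ = [−u*+iv*, u*+iv*]`, `L₄ = [u*+iv*, u*]`, `L₅ = [u*, ∞)` with `u* = 𝓛₂^{−1}𝓛⁵`,
> `v* = π(t₀−x)/𝓛₂²`. If `w ∈ L₁ ∪ L₅`, then `[…] ≪ exp{−𝓛₂²u²}(1 + e^{u/2})`. Thus the left side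
> of (5.11) is trivially `O(ε)` if `j = 1, 5`. By simple estimates,
> `∫_{L_j}|exp{2πi(t₀−x)w − 𝓛₂²w²} dw| ≪ ω(1/2+2πix) + ε` if `j = 2,3,4`. Since `t₀^{3.06}/𝓛₂⁴ ≪ α`,
> we have `f*(x,w) − 1 ≪ |w| + x|w|² ≪ α` for `w ∈ L₂ ∪ L₃ ∪ L₄`. These estimates together imply (5.11).

With `Δ` read through (5.10) (`Lemma53.Delta510`) and `g(w) := exp{lin(w)}(f*(x,w) − 1)`
(`Lemma53.gfun`), this file PROVES, for free reals `L₂ > 0`, `t₀`, `x`, `U ≥ 0` (for `u*`) and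
`V = π(t₀−x)/L₂²` (`= v*`):

* `Lemma53.Delta510_sub_omega_eq` — "By the relation … and": `Δ(x) − ω(1/2+2πix) = ∫_ℝ g(u) du`
  EXACT (M29 `SmoothWeight.integral_cexp_phase_eq_omega` + M30 `cexp_phase_eq_mul_fstar`);
* `Lemma53.integral_gfun_eq_split` — "Cauchy's theorem": `∫_ℝ g = ∫_{L₁} + ∫_{L₅} + (∫_{L₃} +
  ∫_{L₂} + ∫_{L₄})` (Mathlib's Cauchy–Goursat for rectangles; `g` is entire);
* `Lemma53.norm_integral_gfun_L15_le` (j = 1, 5), `norm_integral_gfun_L3_le` (j = 3),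
  `norm_integral_gfun_L24_le` (j = 2, 4) — the three estimates, with explicit constants:
  `≤ ∫_{|u| ≥ U} e^{−L₂²u²}(1+e^{u/2})`, `≤ B·ω(1/2+2πix)`, `≤ B·|V|·e^{−L₂²U²}` where
  `B = ρ + 4π|x|ρ²`, `ρ = √(U²+V²)` (the bound "`|w| + x|w|²`" on `L₂ ∪ L₃ ∪ L₄`), under `ρ ≤ 1`,
  `4π|x|ρ² ≤ 1`;
* `Lemma53.norm_Delta510_sub_omega_le` — **(5.8) in explicit form**:
  `‖Δ(x) − ω(1/2+2πix)‖ ≤ T(U) + B·(ω(1/2+2πix) + 2|V|e^{−L₂²U²})`, `T(U)` the `L₁ ∪ L₅` integral;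
  `Lemma53.tail_le` — `T(U) ≤ (1 + e^{1/(8L₂²)})(√(2π)/L₂)·e^{−L₂²U²/2}`.

With the manuscript's `U = 𝓛₂^{−1}𝓛⁵` (`L₂²U² = 𝓛^{10}`), `|V| ≤ πt₀^{1.02}/𝓛₂²`, `B ≪ α` (their
"`t₀^{3.06}/𝓛₂⁴ ≪ α`"), this is "`Δ(x) = ω(1/2+2πix)(1 + O(α)) + O(ε)`"; that bookkeeping is not
introduced here. The case `x > t₀^{1.02}` ((5.9)/(5.12)) is not assembled here (its pointwise
inputs are in `Section5Lemma53Phase`). Nothing about Theorems 1–2 of the source is stated or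
implied; nothing here bears on the cell's verdict on (8.24).

## References

* Y. Zhang, arXiv:2211.02515v1 (2022), §5 pp. 10–11, Lemma 5.3, (5.8), (5.10), (5.11).
  [cite: Zhang2022LandauSiegel, §5 Lemma 5.3 (proof), (5.8), (5.11)]
-/

noncomputable section

open Complex Real Set MeasureTheory Filter Topology intervalIntegral

namespace Literature.NumberTheory.LFunctions.Zhang2022

namespace Lemma53

open SmoothWeight

/-- The integrand of (5.11): `g(w) = exp{2πi(t₀−x)w − 𝓛₂²w²}(f*(x,w) − 1)`.
[cite: Zhang2022LandauSiegel, §5 (5.11)] -/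
def gfun (L₂ t₀ x : ℝ) (w : ℂ) : ℂ := cexp (lin L₂ t₀ x w) * (fstar x w - 1)

/-- Unfolding lemma for `gfun`. [cite: Zhang2022LandauSiegel, §5 (5.11)] -/
lemma gfun_def (L₂ t₀ x : ℝ) (w : ℂ) :
    gfun L₂ t₀ x w = cexp (lin L₂ t₀ x w) * (fstar x w - 1) := rfl

/-- `g` is entire. [folklore] -/
lemma differentiable_gfun (L₂ t₀ x : ℝ) : Differentiable ℂ (gfun L₂ t₀ x) := by
  unfold gfun lin fstar
  fun_prop

/-- `g` is continuous along any affine path `u ↦ a + u·b`. [folklore] -/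
lemma continuous_gfun_comp (L₂ t₀ x : ℝ) (a b : ℂ) :
    Continuous fun u : ℝ => gfun L₂ t₀ x (a + u * b) :=
  (differentiable_gfun L₂ t₀ x).continuous.comp (by fun_prop)

/-- On the real axis `g(u) = exp{phase(u)} − exp{lin(u)}`. [folklore] -/
lemma gfun_ofReal (L₂ t₀ x u : ℝ) :
    gfun L₂ t₀ x u = cexp (phase L₂ t₀ x u) - cexp (lin L₂ t₀ x u) := by
  rw [gfun_def, cexp_phase_eq_mul_fstar]
  ring

/-- `u ↦ exp{lin(u)}` is integrable (`L₂ ≠ 0`). [folklore] -/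
lemma integrable_cexp_lin {L₂ : ℝ} (hL : L₂ ≠ 0) (t₀ x : ℝ) :
    Integrable fun u : ℝ => cexp (lin L₂ t₀ x u) := by
  have hb : (-(L₂ : ℂ) ^ 2).re < 0 := by
    have : (-(L₂ : ℂ) ^ 2) = ((-(L₂ ^ 2) : ℝ) : ℂ) := by push_cast; ring
    rw [this, ofReal_re]
    have : 0 < L₂ ^ 2 := by positivity
    linarith
  have hg : Integrable fun u : ℝ => cexp (-(L₂ : ℂ) ^ 2 * (u : ℂ) ^ 2 + (2 * π * I * (t₀ - x)) * u + 0) :=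
    integrable_cexp_quadratic' hb _ _
  refine hg.congr (Eventually.of_forall fun u => ?_)
  simp only [lin_def]
  congr 1
  ring

/-- `u ↦ g(u)` is integrable on `ℝ` (`L₂ ≠ 0`). [folklore] -/
lemma integrable_gfun {L₂ : ℝ} (hL : L₂ ≠ 0) (t₀ x : ℝ) :
    Integrable fun u : ℝ => gfun L₂ t₀ x u := by
  have h := (integrable_cexp_phase hL t₀ x).sub (integrable_cexp_lin hL t₀ x)
  refine h.congr (Eventually.of_forall fun u => ?_)
  simp only [Pi.sub_apply, gfun_ofReal]

/-! ## Step 1: `Δ(x) − ω(1/2 + 2πix) = ∫_ℝ g(u) du` -/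

/-- **"By the relation `∫ exp{2πi(t₀−x)u − 𝓛₂²u²} du = ω(1/2+2πix)` …"**: with `Δ` as in (5.10),
`Δ(x) − ω(1/2 + 2πix) = ∫_ℝ exp{2πi(t₀−x)u − 𝓛₂²u²}(f*(x,u) − 1) du`, EXACT (`L₂ > 0`).
[cite: Zhang2022LandauSiegel, §5 Lemma 5.3 (proof), (5.11)] -/
theorem Delta510_sub_omega_eq {L₂ : ℝ} (hL : 0 < L₂) (t₀ x : ℝ) :
    Delta510 L₂ t₀ x - omega L₂ t₀ (1 / 2 + 2 * π * x * I) = ∫ u : ℝ, gfun L₂ t₀ x u := by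
  have h1 : omega L₂ t₀ (1 / 2 + 2 * π * x * I) = ∫ u : ℝ, cexp (lin L₂ t₀ x u) := by
    rw [← integral_cexp_phase_eq_omega hL t₀ x]
    congr 1
  rw [Delta510, h1, ← integral_sub (integrable_cexp_phase hL.ne' t₀ x) (integrable_cexp_lin hL.ne' t₀ x)]
  congr 1
  funext u
  rw [gfun_ofReal]

/-! ## Step 2: Cauchy's theorem for the rectangle `[−U, U] × [0, V]` -/

/-- **"… and Cauchy's theorem"**: for real `U`, `V`,
`∫_ℝ g = ∫_{u ≤ −U} g + ∫_{u > U} g + (∫_{−U}^{U} g(u+iV) du − i∫₀^V g(U+iy) dy + i∫₀^V g(−U+iy) dy)`,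
i.e. `∫_{L₁∪L₅} + ∫_{L₃} + ∫_{L₄} + ∫_{L₂}` (Cauchy–Goursat for the rectangle; `g` is entire).
[cite: Zhang2022LandauSiegel, §5 Lemma 5.3 (proof), (5.11)] -/
theorem integral_gfun_eq_split {L₂ : ℝ} (hL : L₂ ≠ 0) (t₀ x U V : ℝ) :
    ∫ u : ℝ, gfun L₂ t₀ x u
      = (∫ u in Iic (-U), gfun L₂ t₀ x u) + (∫ u in Ioi U, gfun L₂ t₀ x u)
        + ((∫ u in (-U)..U, gfun L₂ t₀ x (u + V * I))
          - I * (∫ y in (0 : ℝ)..V, gfun L₂ t₀ x (U + y * I))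
          + I * (∫ y in (0 : ℝ)..V, gfun L₂ t₀ x (-U + y * I))) := by
  have hint := integrable_gfun hL t₀ x
  rw [← intervalIntegral.integral_Iic_add_Ioi (hint.integrableOn (s := Iic (-U)))
      (hint.integrableOn (s := Ioi (-U))),
    ← intervalIntegral.integral_interval_add_Ioi (hint.integrableOn (s := Ioi (-U)))
      (hint.integrableOn (s := Ioi U))]
  have hrect := Complex.integral_boundary_rect_eq_zero_of_differentiableOn (gfun L₂ t₀ x)
    ((-U : ℝ) : ℂ) ((U : ℂ) + (V : ℂ) * I) (differentiable_gfun L₂ t₀ x).differentiableOn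
  simp only [Complex.add_re, Complex.add_im, Complex.ofReal_re, Complex.ofReal_im,
    Complex.mul_re, Complex.mul_im, Complex.I_re, Complex.I_im, mul_zero, mul_one, sub_zero,
    zero_add, add_zero, Complex.ofReal_zero, zero_mul, smul_eq_mul] at hrect
  have e1 : (∫ u in (-U)..U, gfun L₂ t₀ x ((u : ℂ) + (V : ℂ) * I))
      = ∫ u in (-U)..U, gfun L₂ t₀ x (u + V * I) := rfl
  have e2 : (∫ y in (0 : ℝ)..V, gfun L₂ t₀ x (-(U : ℂ) + (y : ℂ) * I))
      = ∫ y in (0 : ℝ)..V, gfun L₂ t₀ x (-U + y * I) := rfl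
  push_cast at hrect ⊢
  linear_combination hrect

/-! ## Step 3: the three estimates -/

/-- The dominating function on `L₁ ∪ L₅`: `e^{−L₂²u²}(1 + e^{u/2})` is integrable. [folklore] -/
lemma integrable_L15_bound {L₂ : ℝ} (hL : L₂ ≠ 0) :
    Integrable fun u : ℝ => Real.exp (-(L₂ ^ 2 * u ^ 2)) * (1 + Real.exp (u / 2)) := by
  have h0 := integrable_exp_lin_sub_sq hL 0
  have h1 := integrable_exp_lin_sub_sq hL (1 / 2)
  refine (h0.add h1).congr (Eventually.of_forall fun u => ?_)
  simp only [zero_mul, zero_sub, Pi.add_apply]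
  rw [mul_add, mul_one, ← Real.exp_add]
  congr 2
  ring

/-- **`j = 1, 5`**: `‖∫_{u ≤ −U} g‖ + ‖∫_{u > U} g‖ ≤ ∫_{u ≤ −U} e^{−L₂²u²}(1+e^{u/2}) + ∫_{u > U} (same)`
(from "`exp{…}(f*(x,w) − 1) ≪ exp{−𝓛₂²u²}(1 + e^{u/2})` on `L₁ ∪ L₅`", constant `1`).
[cite: Zhang2022LandauSiegel, §5 Lemma 5.3 (proof), (5.11)] -/
theorem norm_integral_gfun_L15_le {L₂ : ℝ} (hL : L₂ ≠ 0) (t₀ x U : ℝ) :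
    ‖∫ u in Iic (-U), gfun L₂ t₀ x u‖ + ‖∫ u in Ioi U, gfun L₂ t₀ x u‖
      ≤ (∫ u in Iic (-U), Real.exp (-(L₂ ^ 2 * u ^ 2)) * (1 + Real.exp (u / 2)))
        + ∫ u in Ioi U, Real.exp (-(L₂ ^ 2 * u ^ 2)) * (1 + Real.exp (u / 2)) := by
  have hpt : ∀ u : ℝ, ‖gfun L₂ t₀ x u‖ ≤ Real.exp (-(L₂ ^ 2 * u ^ 2)) * (1 + Real.exp (u / 2)) :=
    fun u => by rw [gfun_def]; exact norm_lin_mul_fstar_sub_one_le L₂ t₀ x u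
  have hb := integrable_L15_bound hL
  gcongr
  · calc ‖∫ u in Iic (-U), gfun L₂ t₀ x u‖ ≤ ∫ u in Iic (-U), ‖gfun L₂ t₀ x u‖ :=
          norm_integral_le_integral_norm _
      _ ≤ _ := setIntegral_mono_on (integrable_gfun hL t₀ x).norm.integrableOn hb.integrableOn
          measurableSet_Iic fun u _ => hpt u
  · calc ‖∫ u in Ioi U, gfun L₂ t₀ x u‖ ≤ ∫ u in Ioi U, ‖gfun L₂ t₀ x u‖ :=
          norm_integral_le_integral_norm _
      _ ≤ _ := setIntegral_mono_on (integrable_gfun hL t₀ x).norm.integrableOn hb.integrableOn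
          measurableSet_Ioi fun u _ => hpt u

/-- The bound `B = ρ + 4π|x|ρ²` on `|f*(x,w) − 1|` over the rectangle (`‖w‖ ≤ ρ ≤ 1`,
`4π|x|ρ² ≤ 1`). [cite: Zhang2022LandauSiegel, §5 Lemma 5.3 (proof) ("f* − 1 ≪ |w| + x|w|²")] -/
lemma norm_fstar_sub_one_le_of_norm_le {x ρ : ℝ} {w : ℂ} (hw : ‖w‖ ≤ ρ) (hρ : ρ ≤ 1)
    (hxρ : 4 * π * |x| * ρ ^ 2 ≤ 1) :
    ‖fstar x w - 1‖ ≤ ρ + 4 * π * |x| * ρ ^ 2 := by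
  have h0 : 0 ≤ ‖w‖ := norm_nonneg w
  have hw2 : ‖w‖ ^ 2 ≤ ρ ^ 2 := pow_le_pow_left₀ h0 hw 2
  have hπx : 0 ≤ 4 * π * |x| := by positivity
  have h1 : 4 * π * |x| * ‖w‖ ^ 2 ≤ 4 * π * |x| * ρ ^ 2 := by gcongr
  calc ‖fstar x w - 1‖ ≤ ‖w‖ + 4 * π * |x| * ‖w‖ ^ 2 :=
        norm_fstar_sub_one_le (hw.trans hρ) (h1.trans hxρ)
    _ ≤ ρ + 4 * π * |x| * ρ ^ 2 := by gcongr

/-- `‖a + bI‖ ≤ √(U² + V²)` when `a² ≤ U²`, `b² ≤ V²`. [folklore] -/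
lemma norm_add_mul_I_le {a b U V : ℝ} (ha : a ^ 2 ≤ U ^ 2) (hb : b ^ 2 ≤ V ^ 2) :
    ‖(a : ℂ) + (b : ℂ) * I‖ ≤ Real.sqrt (U ^ 2 + V ^ 2) := by
  rw [Complex.norm_add_mul_I, Real.sqrt_le_sqrt_iff (by positivity)]  -- hmm name
  linarith

/-- **`j = 3`**: on `L₃` (`Im w = V = π(t₀−x)/L₂²`),
`‖∫_{−U}^{U} g(u + iV) du‖ ≤ B·ω(1/2+2πix)`, `B = ρ + 4π|x|ρ²`, `ρ = √(U²+V²) ≤ 1`, `4π|x|ρ² ≤ 1`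
(the modulus of `exp{lin}` on `L₃` is exactly `e^{−L₂²u²}e^{−(π(t₀−x)/L₂)²}`, whose integral over
`ℝ` is `ω(1/2+2πix)`). [cite: Zhang2022LandauSiegel, §5 Lemma 5.3 (proof), (5.11)] -/
theorem norm_integral_gfun_L3_le {L₂ : ℝ} (hL : 0 < L₂) (t₀ x : ℝ) {U ρ : ℝ} (hU : 0 ≤ U)
    (hρ : Real.sqrt (U ^ 2 + (π * (t₀ - x) / L₂ ^ 2) ^ 2) ≤ ρ) (hρ1 : ρ ≤ 1)
    (hxρ : 4 * π * |x| * ρ ^ 2 ≤ 1) :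
    ‖∫ u in (-U)..U, gfun L₂ t₀ x (u + (π * (t₀ - x) / L₂ ^ 2 : ℝ) * I)‖
      ≤ (ρ + 4 * π * |x| * ρ ^ 2) * omegaLine L₂ t₀ x := by
  set V : ℝ := π * (t₀ - x) / L₂ ^ 2 with hV
  set B : ℝ := ρ + 4 * π * |x| * ρ ^ 2 with hB
  set K : ℝ := Real.exp (-(π * (t₀ - x) / L₂) ^ 2) with hK
  have hB0 : 0 ≤ B := by
    have : 0 ≤ ρ := (Real.sqrt_nonneg _).trans hρ
    positivity
  -- pointwise bound on L₃
  have hpt : ∀ u ∈ Set.Ioc (-U) U,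
      ‖gfun L₂ t₀ x (u + V * I)‖ ≤ B * K * Real.exp (-(L₂ ^ 2 * u ^ 2)) := by
    intro u hu
    have hu2 : u ^ 2 ≤ U ^ 2 := by
      have h1 : -U < u := hu.1
      have h2 : u ≤ U := hu.2
      nlinarith
    have hw : ‖(u : ℂ) + (V : ℂ) * I‖ ≤ ρ := (norm_add_mul_I_le hu2 le_rfl).trans hρ
    rw [gfun_def, norm_mul, hV, norm_cexp_lin_saddle hL.ne' t₀ x u, ← hV]
    have hf := norm_fstar_sub_one_le_of_norm_le hw hρ1 hxρ
    rw [← hB] at hf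
    have hE : 0 ≤ Real.exp (-(L₂ ^ 2 * u ^ 2)) * K := by positivity
    calc Real.exp (-(L₂ ^ 2 * u ^ 2)) * K * ‖fstar x (u + V * I) - 1‖
        ≤ Real.exp (-(L₂ ^ 2 * u ^ 2)) * K * B := by gcongr
      _ = B * K * Real.exp (-(L₂ ^ 2 * u ^ 2)) := by ring
  have hUU : -U ≤ U := by linarith
  have hcont : Continuous fun u : ℝ => B * K * Real.exp (-(L₂ ^ 2 * u ^ 2)) := by fun_prop
  calc ‖∫ u in (-U)..U, gfun L₂ t₀ x (u + V * I)‖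
      ≤ ∫ u in (-U)..U, B * K * Real.exp (-(L₂ ^ 2 * u ^ 2)) :=
        intervalIntegral.norm_integral_le_of_norm_le hUU (Eventually.of_forall hpt)
          (hcont.intervalIntegrable _ _)
    _ = B * K * ∫ u in (-U)..U, Real.exp (-(L₂ ^ 2 * u ^ 2)) := by
        rw [intervalIntegral.integral_const_mul]
    _ ≤ B * K * ∫ u : ℝ, Real.exp (-(L₂ ^ 2 * u ^ 2)) := by
        have hgi : Integrable fun u : ℝ => Real.exp (-(L₂ ^ 2 * u ^ 2)) := by
          have := integrable_exp_neg_mul_sq (show 0 < L₂ ^ 2 by positivity)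
          refine this.congr (Eventually.of_forall fun u => ?_)
          simp only; congr 1; ring
        have hle : ∫ u in (-U)..U, Real.exp (-(L₂ ^ 2 * u ^ 2))
            ≤ ∫ u : ℝ, Real.exp (-(L₂ ^ 2 * u ^ 2)) := by
          rw [intervalIntegral.integral_of_le hUU]
          exact setIntegral_le_integral hgi (Eventually.of_forall fun u => (Real.exp_pos _).le)
        have : 0 ≤ B * K := by positivity
        exact mul_le_mul_of_nonneg_left hle this
    _ = B * omegaLine L₂ t₀ x := by
        have hg : ∫ u : ℝ, Real.exp (-(L₂ ^ 2 * u ^ 2)) = Real.sqrt π / L₂ := by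
          have := integral_gaussian (L₂ ^ 2)
          have e : (fun u : ℝ => Real.exp (-(L₂ ^ 2) * u ^ 2))
              = fun u : ℝ => Real.exp (-(L₂ ^ 2 * u ^ 2)) := by
            funext u; congr 1; ring
          rw [e] at this
          rw [this, Real.sqrt_div' _ (by positivity), Real.sqrt_sq hL.le]
        rw [hg, omegaLine_def, hK, mul_assoc]
        congr 1
        rw [show (π * (x - t₀) / L₂) ^ 2 = (π * (t₀ - x) / L₂) ^ 2 by ring]
        ring

/-- **`j = 2, 4`**: on the vertical segments (`Re w = ±U`, `Im w` from `0` to `V = π(t₀−x)/L₂²`),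
`‖i∫₀^V g(±U + iy) dy‖ ≤ B·|V|·e^{−L₂²U²}` (`B`, `ρ` as for `j = 3`).
[cite: Zhang2022LandauSiegel, §5 Lemma 5.3 (proof), (5.11)] -/
theorem norm_integral_gfun_L24_le {L₂ : ℝ} (hL : 0 < L₂) (t₀ x : ℝ) {U ρ : ℝ}
    (hρ : Real.sqrt (U ^ 2 + (π * (t₀ - x) / L₂ ^ 2) ^ 2) ≤ ρ) (hρ1 : ρ ≤ 1)
    (hxρ : 4 * π * |x| * ρ ^ 2 ≤ 1) {a : ℝ} (ha : a = U ∨ a = -U) :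
    ‖I * ∫ y in (0 : ℝ)..(π * (t₀ - x) / L₂ ^ 2), gfun L₂ t₀ x (a + y * I)‖
      ≤ (ρ + 4 * π * |x| * ρ ^ 2) * |π * (t₀ - x) / L₂ ^ 2| * Real.exp (-(L₂ ^ 2 * U ^ 2)) := by
  set V : ℝ := π * (t₀ - x) / L₂ ^ 2 with hV
  set B : ℝ := ρ + 4 * π * |x| * ρ ^ 2 with hB
  have ha2 : a ^ 2 = U ^ 2 := by rcases ha with h | h <;> rw [h]; ring
  have hpt : ∀ y ∈ Set.uIoc (0 : ℝ) V,
      ‖gfun L₂ t₀ x (a + y * I)‖ ≤ B * Real.exp (-(L₂ ^ 2 * U ^ 2)) := by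
    intro y hy
    have hyV : (y - V) ^ 2 ≤ V ^ 2 ∧ y ^ 2 ≤ V ^ 2 := by
      rcases le_or_gt 0 V with hV0 | hV0
      · rw [Set.uIoc_of_le hV0] at hy
        have := hy.1; have := hy.2
        constructor <;> nlinarith
      · rw [Set.uIoc_of_ge hV0.le] at hy
        have := hy.1; have := hy.2
        constructor <;> nlinarith
    have hy' := hyV.1
    have hy2 := hyV.2
    have hw : ‖(a : ℂ) + (y : ℂ) * I‖ ≤ ρ := (norm_add_mul_I_le (le_of_eq ha2) hy2).trans hρ
    rw [gfun_def, norm_mul]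
    have h1 : ‖cexp (lin L₂ t₀ x (a + y * I))‖ ≤ Real.exp (-(L₂ ^ 2 * U ^ 2)) := by
      rw [← ha2]
      exact norm_cexp_lin_vertical_le hL.ne' t₀ x a (by rw [← hV]; exact hy')
    have h2 := norm_fstar_sub_one_le_of_norm_le hw hρ1 hxρ
    rw [← hB] at h2
    have hB0 : 0 ≤ B := (norm_nonneg _).trans h2
    calc ‖cexp (lin L₂ t₀ x (a + y * I))‖ * ‖fstar x (a + y * I) - 1‖
        ≤ Real.exp (-(L₂ ^ 2 * U ^ 2)) * B :=
          mul_le_mul h1 h2 (norm_nonneg _) (Real.exp_pos _).le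
      _ = B * Real.exp (-(L₂ ^ 2 * U ^ 2)) := by ring
  rw [norm_mul, Complex.norm_I, one_mul]
  calc ‖∫ y in (0 : ℝ)..V, gfun L₂ t₀ x (a + y * I)‖
      ≤ B * Real.exp (-(L₂ ^ 2 * U ^ 2)) * |V - 0| :=
        intervalIntegral.norm_integral_le_of_norm_le_const hpt
    _ = B * |V| * Real.exp (-(L₂ ^ 2 * U ^ 2)) := by rw [sub_zero]; ring

/-! ## (5.8) in explicit form -/

/-- **(5.8), explicit**: for `L₂ > 0`, `U ≥ 0`, `V = π(t₀−x)/L₂²`, `ρ` with `√(U²+V²) ≤ ρ ≤ 1` and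
`4π|x|ρ² ≤ 1`:
`‖Δ(x) − ω(1/2+2πix)‖ ≤ T(U) + (ρ + 4π|x|ρ²)·(ω(1/2+2πix) + 2|V|e^{−L₂²U²})`,
where `T(U) = ∫_{u ≤ −U} e^{−L₂²u²}(1+e^{u/2}) du + ∫_{u > U} e^{−L₂²u²}(1+e^{u/2}) du`
(the source: "`Δ(x) = ω(1/2+2πix)(1 + O(α)) + O(ε)`").
[cite: Zhang2022LandauSiegel, §5 Lemma 5.3, (5.8)] -/
theorem norm_Delta510_sub_omega_le {L₂ : ℝ} (hL : 0 < L₂) (t₀ x : ℝ) {U ρ : ℝ} (hU : 0 ≤ U)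
    (hρ : Real.sqrt (U ^ 2 + (π * (t₀ - x) / L₂ ^ 2) ^ 2) ≤ ρ) (hρ1 : ρ ≤ 1)
    (hxρ : 4 * π * |x| * ρ ^ 2 ≤ 1) :
    ‖Delta510 L₂ t₀ x - omega L₂ t₀ (1 / 2 + 2 * π * x * I)‖
      ≤ ((∫ u in Iic (-U), Real.exp (-(L₂ ^ 2 * u ^ 2)) * (1 + Real.exp (u / 2)))
          + ∫ u in Ioi U, Real.exp (-(L₂ ^ 2 * u ^ 2)) * (1 + Real.exp (u / 2)))
        + (ρ + 4 * π * |x| * ρ ^ 2) * (omegaLine L₂ t₀ x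
          + 2 * |π * (t₀ - x) / L₂ ^ 2| * Real.exp (-(L₂ ^ 2 * U ^ 2))) := by
  set V : ℝ := π * (t₀ - x) / L₂ ^ 2 with hV
  set B : ℝ := ρ + 4 * π * |x| * ρ ^ 2 with hB
  rw [Delta510_sub_omega_eq hL, integral_gfun_eq_split hL.ne' t₀ x U V]
  have h15 := norm_integral_gfun_L15_le hL.ne' t₀ x U
  have h3 := norm_integral_gfun_L3_le hL t₀ x hU hρ hρ1 hxρ
  have h2 := norm_integral_gfun_L24_le hL t₀ x hρ hρ1 hxρ (a := U) (Or.inl rfl)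
  have h4 := norm_integral_gfun_L24_le hL t₀ x hρ hρ1 hxρ (a := -U) (Or.inr rfl)
  push_cast at h4
  rw [← hV] at h3 h2 h4
  rw [← hB] at h3 h2 h4
  calc ‖(∫ u in Iic (-U), gfun L₂ t₀ x u) + (∫ u in Ioi U, gfun L₂ t₀ x u)
        + ((∫ u in (-U)..U, gfun L₂ t₀ x (u + V * I))
          - I * (∫ y in (0 : ℝ)..V, gfun L₂ t₀ x (U + y * I))
          + I * (∫ y in (0 : ℝ)..V, gfun L₂ t₀ x (-U + y * I)))‖
      ≤ ‖∫ u in Iic (-U), gfun L₂ t₀ x u‖ + ‖∫ u in Ioi U, gfun L₂ t₀ x u‖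
        + (‖∫ u in (-U)..U, gfun L₂ t₀ x (u + V * I)‖
          + ‖I * (∫ y in (0 : ℝ)..V, gfun L₂ t₀ x (U + y * I))‖
          + ‖I * (∫ y in (0 : ℝ)..V, gfun L₂ t₀ x (-U + y * I))‖) := by
        refine (norm_add_le _ _).trans (add_le_add ((norm_add_le _ _).trans le_rfl) ?_)
        refine (norm_add_le _ _).trans (add_le_add ((norm_sub_le _ _).trans le_rfl) le_rfl)
    _ ≤ ((∫ u in Iic (-U), Real.exp (-(L₂ ^ 2 * u ^ 2)) * (1 + Real.exp (u / 2)))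
          + ∫ u in Ioi U, Real.exp (-(L₂ ^ 2 * u ^ 2)) * (1 + Real.exp (u / 2)))
        + (B * omegaLine L₂ t₀ x + B * |V| * Real.exp (-(L₂ ^ 2 * U ^ 2))
          + B * |V| * Real.exp (-(L₂ ^ 2 * U ^ 2))) := by
        gcongr ?_ + (?_ + ?_ + ?_)
    _ = _ := by ring

/-! ## The `L₁ ∪ L₅` tail: "trivially `O(ε)`" -/

/-- `∫_ℝ e^{u/2 − L₂²u²/2} du = e^{1/(8L₂²)}·√(2π)/L₂` (completing the square). [folklore] -/
lemma integral_exp_half_sub_sq {L₂ : ℝ} (hL : 0 < L₂) :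
    ∫ u : ℝ, Real.exp (u / 2 - L₂ ^ 2 * u ^ 2 / 2)
      = Real.exp (1 / (8 * L₂ ^ 2)) * (Real.sqrt (2 * π) / L₂) := by
  have hL2 : 0 < L₂ ^ 2 / 2 := by positivity
  have e : (fun u : ℝ => Real.exp (u / 2 - L₂ ^ 2 * u ^ 2 / 2))
      = fun u : ℝ => Real.exp (1 / (8 * L₂ ^ 2))
          * (fun y : ℝ => Real.exp (-(L₂ ^ 2 / 2) * y ^ 2)) (u - 1 / (2 * L₂ ^ 2)) := by
    funext u
    simp only
    rw [← Real.exp_add]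
    congr 1
    field_simp
    ring
  rw [e, MeasureTheory.integral_const_mul,
    integral_sub_right_eq_self (fun y : ℝ => Real.exp (-(L₂ ^ 2 / 2) * y ^ 2)) (1 / (2 * L₂ ^ 2)),
    integral_gaussian]
  congr 1
  rw [show π / (L₂ ^ 2 / 2) = 2 * π / L₂ ^ 2 by field_simp, Real.sqrt_div' _ (by positivity),
    Real.sqrt_sq hL.le]

/-- `∫_ℝ e^{−L₂²u²/2} du = √(2π)/L₂`. [folklore] -/
lemma integral_exp_neg_sq_half {L₂ : ℝ} (hL : 0 < L₂) :
    ∫ u : ℝ, Real.exp (-(L₂ ^ 2 * u ^ 2 / 2)) = Real.sqrt (2 * π) / L₂ := by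
  have := integral_gaussian (L₂ ^ 2 / 2)
  have e : (fun u : ℝ => Real.exp (-(L₂ ^ 2 / 2) * u ^ 2))
      = fun u : ℝ => Real.exp (-(L₂ ^ 2 * u ^ 2 / 2)) := by
    funext u; congr 1; ring
  rw [e] at this
  rw [this, show π / (L₂ ^ 2 / 2) = 2 * π / L₂ ^ 2 by field_simp, Real.sqrt_div' _ (by positivity),
    Real.sqrt_sq hL.le]

/-- **"Thus the left side of (5.11) is trivially `O(ε)` if `j = 1, 5`"**, explicitly: for `L₂ > 0`,
`U ≥ 0`, `T(U) ≤ (1 + e^{1/(8L₂²)})·(√(2π)/L₂)·e^{−L₂²U²/2}` (with the manuscript's `U = u*`,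
`L₂²U² = 𝓛^{10}`). [cite: Zhang2022LandauSiegel, §5 Lemma 5.3 (proof), (5.11)] -/
theorem tail_le {L₂ : ℝ} (hL : 0 < L₂) {U : ℝ} (hU : 0 ≤ U) :
    (∫ u in Iic (-U), Real.exp (-(L₂ ^ 2 * u ^ 2)) * (1 + Real.exp (u / 2)))
        + (∫ u in Ioi U, Real.exp (-(L₂ ^ 2 * u ^ 2)) * (1 + Real.exp (u / 2)))
      ≤ (1 + Real.exp (1 / (8 * L₂ ^ 2))) * (Real.sqrt (2 * π) / L₂)
          * Real.exp (-(L₂ ^ 2 * U ^ 2 / 2)) := by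
  -- the majorant `h(u) = e^{−L₂²U²/2}(e^{−L₂²u²/2} + e^{u/2 − L₂²u²/2})`, valid for `|u| ≥ U`
  set h : ℝ → ℝ := fun u => Real.exp (-(L₂ ^ 2 * U ^ 2 / 2))
      * (Real.exp (-(L₂ ^ 2 * u ^ 2 / 2)) + Real.exp (u / 2 - L₂ ^ 2 * u ^ 2 / 2)) with hh
  have hL2 : 0 < L₂ ^ 2 := by positivity
  have hi1 : Integrable fun u : ℝ => Real.exp (-(L₂ ^ 2 * u ^ 2 / 2)) := by
    have := integrable_exp_neg_mul_sq (show 0 < L₂ ^ 2 / 2 by positivity)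
    refine this.congr (Eventually.of_forall fun u => ?_); simp only; congr 1; ring
  have hi2 : Integrable fun u : ℝ => Real.exp (u / 2 - L₂ ^ 2 * u ^ 2 / 2) := by
    have hL' : Real.sqrt (L₂ ^ 2 / 2) ≠ 0 := (Real.sqrt_pos.mpr (by positivity)).ne'
    have := integrable_exp_lin_sub_sq hL' (1 / 2)
    refine this.congr (Eventually.of_forall fun u => ?_)
    simp only
    rw [Real.sq_sqrt (by positivity)]
    congr 1; ring
  have hint : Integrable h := ((hi1.add hi2).const_mul _)
  have hpt : ∀ u : ℝ, U ≤ |u| →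
      Real.exp (-(L₂ ^ 2 * u ^ 2)) * (1 + Real.exp (u / 2)) ≤ h u := by
    intro u hu
    have hu2 : U ^ 2 ≤ u ^ 2 := by
      calc U ^ 2 ≤ |u| ^ 2 := pow_le_pow_left₀ hU hu 2
        _ = u ^ 2 := sq_abs u
    have key : -(L₂ ^ 2 * u ^ 2) ≤ -(L₂ ^ 2 * U ^ 2 / 2) + -(L₂ ^ 2 * u ^ 2 / 2) := by nlinarith
    have hA : Real.exp (-(L₂ ^ 2 * u ^ 2))
        ≤ Real.exp (-(L₂ ^ 2 * U ^ 2 / 2)) * Real.exp (-(L₂ ^ 2 * u ^ 2 / 2)) := by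
      rw [← Real.exp_add]; exact Real.exp_le_exp.mpr key
    have hB : Real.exp (-(L₂ ^ 2 * u ^ 2)) * Real.exp (u / 2)
        ≤ Real.exp (-(L₂ ^ 2 * U ^ 2 / 2)) * Real.exp (u / 2 - L₂ ^ 2 * u ^ 2 / 2) := by
      rw [← Real.exp_add, ← Real.exp_add]; exact Real.exp_le_exp.mpr (by linarith)
    rw [hh]
    simp only
    calc Real.exp (-(L₂ ^ 2 * u ^ 2)) * (1 + Real.exp (u / 2))
        = Real.exp (-(L₂ ^ 2 * u ^ 2)) + Real.exp (-(L₂ ^ 2 * u ^ 2)) * Real.exp (u / 2) := by ring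
      _ ≤ Real.exp (-(L₂ ^ 2 * U ^ 2 / 2)) * Real.exp (-(L₂ ^ 2 * u ^ 2 / 2))
          + Real.exp (-(L₂ ^ 2 * U ^ 2 / 2)) * Real.exp (u / 2 - L₂ ^ 2 * u ^ 2 / 2) :=
          add_le_add hA hB
      _ = _ := by ring
  have hnn : ∀ u : ℝ, 0 ≤ h u := fun u => by rw [hh]; positivity
  have hb := integrable_L15_bound hL.ne'
  calc (∫ u in Iic (-U), Real.exp (-(L₂ ^ 2 * u ^ 2)) * (1 + Real.exp (u / 2)))
        + (∫ u in Ioi U, Real.exp (-(L₂ ^ 2 * u ^ 2)) * (1 + Real.exp (u / 2)))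
      ≤ (∫ u in Iic (-U), h u) + ∫ u in Ioi U, h u := by
        refine add_le_add ?_ ?_
        · exact setIntegral_mono_on hb.integrableOn hint.integrableOn measurableSet_Iic
            fun u hu => hpt u (by
              have : u ≤ -U := hu
              rw [abs_of_nonpos (by linarith)]; linarith)
        · exact setIntegral_mono_on hb.integrableOn hint.integrableOn measurableSet_Ioi
            fun u hu => hpt u (by
              have : U < u := hu
              rw [abs_of_nonneg (by linarith)]; linarith)
    _ ≤ (∫ u in Iic (-U), h u) + ∫ u in Ioi (-U), h u := by
        have hmono : ∫ u in Ioi U, h u ≤ ∫ u in Ioi (-U), h u :=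
          setIntegral_mono_set hint.integrableOn (Eventually.of_forall hnn)
            (Eventually.of_forall fun u (hu : U < u) => show -U < u by linarith)
        linarith
    _ = ∫ u : ℝ, h u := intervalIntegral.integral_Iic_add_Ioi hint.integrableOn hint.integrableOn
    _ = (1 + Real.exp (1 / (8 * L₂ ^ 2))) * (Real.sqrt (2 * π) / L₂)
          * Real.exp (-(L₂ ^ 2 * U ^ 2 / 2)) := by
        rw [hh, MeasureTheory.integral_const_mul, integral_add hi1 hi2, integral_exp_neg_sq_half hL,
          integral_exp_half_sub_sq hL]
        ring

end Lemma53

end Literature.NumberTheory.LFunctions.Zhang2022
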